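import Mathlib
import Summits.ValiantsHypothesis.ValiantsHypothesis.Theses.FifoMatching
import Summits.ValiantsHypothesis.ValiantsHypothesis.Theorems.FifoMatchingNNNotVPSupportFnHardOfCore
import Summits.ValiantsHypothesis.ValiantsHypothesis.Theorems.FifoMatchingNNNotVPStubCertificateToSupportFn
import Literature.Computability.AlgebraicComplexity.NestFreeMatchingPoly
import HarnessLib

/-!
# Route FifoMatching — crux `NNNotVP` (stmt-ValiantsHypothesis-11615), line `division_split`:
# the line from its two open CORES, by name

Registered line `Cruxes/NNNotVP/Lines/division_split.lean` (`NNNotVP ⟸ Z ∧ NNDivisionHard`,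
`NNDivisionHard ⟸ A ∧ B1 ∧ B2`; B1 `stub_certificateToSupportFn` LANDED, p582087).  With the
reduction `supportFnHard_of_core` (stub A ⟸ its free-arc-free core, companion file) the line's two
remaining NN-specific inputs are

* the CORE of A — for all `c` and all large `n`, every nonnegative polynomial with the support
  function of `NN_n` has `L₊ > 2^((log₂ n + c)^c)` (a super-quasi-polynomial monotone Boolean circuit
  lower bound for nest-free perfect-matching = shuffle-square recognition on ordered graphs; OPEN);
* B2 `stub_spreadCofactorReduction` — every nonzero cofactor of `NN_n` can be traded, at
  quasi-polynomial cost, for one with a monomial of polylog support (OPEN);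

and this file records the compositions BY NAME of the route decls:

* `nnDivisionHard_of_stubs` — A → B2 → `Theses.FifoMatching.NNDivisionHard` (B1 discharged by name;
  the skeleton's `nnDivisionHard_of`, whose conclusion was inlined, now concluding the route decl of
  item stmt-ValiantsHypothesis-21181);
* `nnDivisionHard_of_core` — core of A → B2 → `Theses.FifoMatching.NNDivisionHard`;
* `nnNotVP_of_core` — `Theses.DivisionGap.ZeroOneTransfer` (Z, item stmt-5066) → core of A → B2 →
  `Theses.FifoMatching.NNNotVP` (the glue argument of the landed `NNNotVPSplit.nnNotVP_of_subs`).

Honest framing: compositions only; Z, the core of A and B2 are OPEN, so are `NNDivisionHard`,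
`NNNotVP` and `VP ≠ VNP` (NOT proved).  No definitions, no named facts.
-/

noncomputable section

-- Sub = Summit single-conjunct layout: the duplicated namespace component is mandated by the tree.
set_option linter.dupNamespace false

namespace Summit.ValiantsHypothesis.ValiantsHypothesis.Theorems.FifoMatching.NNNotVP.DivisionSplit

open MvPolynomial Literature.Computability.AlgebraicComplexity
open scoped NNReal BigOperators Classical

/-- **A → B2 → `NNDivisionHard` by name** (B1 = the landed `stub_certificateToSupportFn`): given
`c`, take `k` from B2 and `C` from quasi-polynomial absorption (inlined; the argument of
`DivisionGapZeroOneTransfer.Split.qp_absorb`); beyond the `n₀` of A at `(k, C)`, a certificate `L₊(NN_n h) + L₊(h) ≤ 2^((log₂ n + c)^c)` would give (B2) a cheap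
`NN_n h'` whose cofactor has a monomial of polylog support, hence (B1) a cheap polynomial with the
support function of `NN_n` with those arcs freed — contradicting A.  (The skeleton's
`nnDivisionHard_of`, concluding the route decl; its inlined `NN_n` is definitionally the library's
`nestFreeMatchingPoly n ℝ≥0`.) [folklore] -/
theorem nnDivisionHard_of_stubs
    (hA : ∀ k c : ℕ, ∃ n₀ : ℕ, ∀ n ≥ n₀, ∀ T : Finset (σ n), T.card ≤ (Nat.log 2 n + k) ^ k →
      ∀ g : MvPolynomial (σ n) ℝ≥0, (∀ A : Finset (σ n), SuppFn g A ↔ SuppFn (freeVars T (NN n)) A) →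
        2 ^ ((Nat.log 2 n + c) ^ c) < complexity g)
    (hB2 : ∃ k : ℕ, ∀ (n : ℕ) (h : MvPolynomial (σ n) ℝ≥0), h ≠ 0 →
      ∃ h' : MvPolynomial (σ n) ℝ≥0, (∃ m ∈ h'.support, m.support.card ≤ (Nat.log 2 n + k) ^ k) ∧
        complexity (NN n * h') ≤
          2 ^ ((Nat.log 2 n + Nat.log 2 (complexity (NN n * h) + complexity h) + k) ^ k)) :
    Summit.ValiantsHypothesis.ValiantsHypothesis.Theses.FifoMatching.NNDivisionHard := by
  intro c
  obtain ⟨k, hk⟩ := hB2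
  -- quasi-polynomial absorption (the argument of `DivisionGapZeroOneTransfer.Split.qp_absorb`,
  -- inlined: that module is not co-built with this one on the farm)
  obtain ⟨C, hC⟩ : ∃ C : ℕ, ∀ a : ℕ, (a + (a + c) ^ c + k) ^ k ≤ (a + C) ^ C := by
    have base : ∀ a : ℕ, a + (a + c) ^ c + k ≤ (a + c + k + 1) ^ (c + 1) := by
      intro a
      rcases Nat.eq_zero_or_pos c with hc | hc
      · subst hc; simp; omega
      have hb2 : 2 ≤ a + c + k + 1 := by omega
      have h2 : (a + c) ^ c ≤ (a + c + k + 1) ^ c := Nat.pow_le_pow_left (by omega) c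
      have hbc : a + c + k + 1 ≤ (a + c + k + 1) ^ c := by
        calc a + c + k + 1 = (a + c + k + 1) ^ 1 := (pow_one _).symm
          _ ≤ (a + c + k + 1) ^ c := Nat.pow_le_pow_right (by omega) hc
      calc a + (a + c) ^ c + k = (a + k) + (a + c) ^ c := by ring
        _ ≤ (a + c + k + 1) + (a + c + k + 1) ^ c := Nat.add_le_add (by omega) h2
        _ ≤ (a + c + k + 1) ^ c + (a + c + k + 1) ^ c := Nat.add_le_add_right hbc _
        _ = 2 * (a + c + k + 1) ^ c := by ring
        _ ≤ (a + c + k + 1) * (a + c + k + 1) ^ c := Nat.mul_le_mul_right _ hb2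
        _ = (a + c + k + 1) ^ (c + 1) := by ring
    refine ⟨(c + 1) * (k + 1) + 1, fun a => ?_⟩
    have hCk : (c + 1) * k ≤ (c + 1) * (k + 1) + 1 := by nlinarith
    calc (a + (a + c) ^ c + k) ^ k ≤ ((a + c + k + 1) ^ (c + 1)) ^ k :=
          Nat.pow_le_pow_left (base a) k
      _ = (a + c + k + 1) ^ ((c + 1) * k) := by rw [← pow_mul]
      _ ≤ (a + ((c + 1) * (k + 1) + 1)) ^ ((c + 1) * k) :=
          Nat.pow_le_pow_left (by nlinarith) _
      _ ≤ (a + ((c + 1) * (k + 1) + 1)) ^ ((c + 1) * (k + 1) + 1) :=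
          Nat.pow_le_pow_right (by omega) hCk
  obtain ⟨n₀, hn₀⟩ := hA k C
  refine ⟨n₀, fun n hn h hh => ?_⟩
  -- the route's inline `NN_n` is definitionally the library's `nestFreeMatchingPoly n ℝ≥0`
  show 2 ^ ((Nat.log 2 n + c) ^ c) < complexity (NN n * h) + complexity h
  by_contra hle
  push Not at hle
  -- B2: a cheap certificate whose cofactor has a monomial of polylog support
  obtain ⟨h', ⟨m, hm, hcard⟩, hcost⟩ := hk n h hh
  -- the old cost is `≤ 2^((log₂ n + c)^c)`, so its logarithm is `≤ (log₂ n + c)^c`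
  have hlog : Nat.log 2 (complexity (NN n * h) + complexity h) ≤ (Nat.log 2 n + c) ^ c := by
    calc Nat.log 2 (complexity (NN n * h) + complexity h)
        ≤ Nat.log 2 (2 ^ ((Nat.log 2 n + c) ^ c)) := Nat.log_mono_right hle
      _ = (Nat.log 2 n + c) ^ c := Nat.log_pow (by norm_num) _
  have hcost' : complexity (NN n * h') ≤ 2 ^ ((Nat.log 2 n + C) ^ C) := by
    refine hcost.trans ?_
    refine Nat.pow_le_pow_right (by norm_num) ?_
    refine le_trans ?_ (hC (Nat.log 2 n))
    exact Nat.pow_le_pow_left (by omega) k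
  -- B1: a polynomial with the support function of `NN_n` with the arcs of `m` freed, no costlier
  obtain ⟨g, hg, hgc⟩ := stub_certificateToSupportFn n h' m hm
  -- A: such a polynomial is expensive
  have hlt := hn₀ n hn m.support hcard g hg
  exact absurd (lt_of_lt_of_le hlt (hgc.trans hcost')) (lt_irrefl _)

/-- **Core of A → B2 → `NNDivisionHard` by name**: the line's new piece from its two OPEN cores
(`supportFnHard_of_core` upgrades the core to stub A; B1 is landed). [folklore] -/
theorem nnDivisionHard_of_core
    (hA₀ : ∀ c : ℕ, ∃ n₀ : ℕ, ∀ n ≥ n₀, ∀ g : MvPolynomial (σ n) ℝ≥0,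
      (∀ A : Finset (σ n), SuppFn g A ↔ SuppFn (NN n) A) →
        2 ^ ((Nat.log 2 n + c) ^ c) < complexity g)
    (hB2 : ∃ k : ℕ, ∀ (n : ℕ) (h : MvPolynomial (σ n) ℝ≥0), h ≠ 0 →
      ∃ h' : MvPolynomial (σ n) ℝ≥0, (∃ m ∈ h'.support, m.support.card ≤ (Nat.log 2 n + k) ^ k) ∧
        complexity (NN n * h') ≤
          2 ^ ((Nat.log 2 n + Nat.log 2 (complexity (NN n * h) + complexity h) + k) ^ k)) :
    Summit.ValiantsHypothesis.ValiantsHypothesis.Theses.FifoMatching.NNDivisionHard :=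
  nnDivisionHard_of_stubs (supportFnHard_of_core hA₀) hB2

/-- **Z → core of A → B2 → `NNNotVP` by name**: the whole line `division_split` from the shared
transfer `Theses.DivisionGap.ZeroOneTransfer` (item stmt-ValiantsHypothesis-5066) and the two OPEN
NN-specific cores (the glue step is the argument of the landed `NNNotVPSplit.nnNotVP_of_subs`,
repeated here so that this module does not import a second route-dependent module: if `NN ∈ VP_ℂ`,
the transfer applied to `NN` over `ℝ≥0` — 0/1 coefficients, complexification `= NN` over `ℂ` —
bounds its division complexity by `2^((log₂ n + c)^c)` for all `n`, and `NNDivisionHard` at this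
`c` exceeds it at `n = n₀`). [folklore] -/
theorem nnNotVP_of_core
    (hZ : Summit.ValiantsHypothesis.ValiantsHypothesis.Theses.DivisionGap.ZeroOneTransfer)
    (hA₀ : ∀ c : ℕ, ∃ n₀ : ℕ, ∀ n ≥ n₀, ∀ g : MvPolynomial (σ n) ℝ≥0,
      (∀ A : Finset (σ n), SuppFn g A ↔ SuppFn (NN n) A) →
        2 ^ ((Nat.log 2 n + c) ^ c) < complexity g)
    (hB2 : ∃ k : ℕ, ∀ (n : ℕ) (h : MvPolynomial (σ n) ℝ≥0), h ≠ 0 →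
      ∃ h' : MvPolynomial (σ n) ℝ≥0, (∃ m ∈ h'.support, m.support.card ≤ (Nat.log 2 n + k) ^ k) ∧
        complexity (NN n * h') ≤
          2 ^ ((Nat.log 2 n + Nat.log 2 (complexity (NN n * h) + complexity h) + k) ^ k)) :
    Summit.ValiantsHypothesis.ValiantsHypothesis.Theses.FifoMatching.NNNotVP := by
  have hNN := nnDivisionHard_of_core hA₀ hB2
  intro hVP
  have hcoeff : ∀ (n : ℕ) (m : (Fin (2 * n) × Fin (2 * n)) →₀ ℕ),
      MvPolynomial.coeff m (nestFreeMatchingPoly n NNReal) = 0 ∨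
      MvPolynomial.coeff m (nestFreeMatchingPoly n NNReal) = 1 :=
    fun n m => coeff_nestFreeMatchingPoly_eq_zero_or_eq_one n m
  have hmap : (fun n => MvPolynomial.map (Complex.ofRealHom.comp NNReal.toRealHom)
        (nestFreeMatchingPoly n NNReal)) = fun n => nestFreeMatchingPoly n ℂ := by
    funext n
    exact map_nestFreeMatchingPoly n _
  have hVP' : IsVPFamily (k := ℂ)
      (fun n => MvPolynomial.map (Complex.ofRealHom.comp NNReal.toRealHom)
        (nestFreeMatchingPoly n NNReal)) := by
    rw [hmap]
    exact hVP
  obtain ⟨c, hc⟩ := hZ (fun n => Fin (2 * n) × Fin (2 * n))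
    (fun n => nestFreeMatchingPoly n NNReal) hcoeff hVP'
  obtain ⟨n₀, hn₀⟩ := hNN c
  obtain ⟨h, hh, hle⟩ := hc n₀
  have hlt := hn₀ n₀ le_rfl h hh
  exact absurd (lt_of_lt_of_le hlt hle) (lt_irrefl _)

end Summit.ValiantsHypothesis.ValiantsHypothesis.Theorems.FifoMatching.NNNotVP.DivisionSplit

end
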